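import Literature.Analysis.InverseSpectral.KreinStringCalculus
import Literature.Analysis.InverseSpectral.KreinStringPositivity
import HarnessLib

/-!
# Kreĭn strings: the principal Titchmarsh–Weyl function on the negative axis

For a Kreĭn string `S[m, L]` with fundamental system `φ(·, z)`, `ψ(·, z)` (`KreinString.phi`,
`KreinString.psi`) we prove the finite-depth identity behind Tomisaki 1988 (4.1),

  `ψ(x, z)/φ(x, z) = ∫₀ˣ φ(t, z)⁻² dt`  whenever `φ(·, z)` has no zero on `[0, x]`

(`psi_div_phi_eq_integral`; right derivatives of `φ`, `ψ` by the fundamental theorem of calculus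
for the right-continuous integrands `φ⁺' = -z ∫_{[0,·]} φ dm`, `ψ⁺' = 1 - z ∫_{[0,·]} ψ dm`, the
quotient rule and the Lagrange identity `φψ⁺' - φ⁺'ψ = 1`), and deduce the existence of the
principal Titchmarsh–Weyl function on the negative real axis: for `s > 0` and every string other
than the free half-line `S[0, ∞]`, `x ↦ ψ(x, -s)/φ(x, -s) = ∫₀ˣ φ(t, -s)⁻² dt` is non-decreasing
and bounded on
`[0, L)`, hence converges as `x → L`:

  `q_S(-s) = lim_{x → L} ψ(x, -s)/φ(x, -s) = ∫₀ᴸ φ(t, -s)⁻² dt ∈ (0, ∞)`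

(`exists_tendsto_psi_div_phi_neg`, `tendsto_principalWeylFunction_of_neg`). This is part (i) of
`KreinInverseSpectralTheorem` restricted to `z ∈ (-∞, 0)` [cite: Tomisaki1988, §4 (4.1)];
[cite: KacKrein1974, §2].

## References

Tomisaki1988 (§4, (4.1)), KacKrein1974 (§§1–2), DymMcKean1976 (Ch. 5).
-/

open MeasureTheory Filter Set Topology
open scoped ENNReal Nat

noncomputable section

namespace Literature.Analysis.InverseSpectral

/-- Right-continuity of a Stieltjes primitive: for `g` `ν`-integrable on `[0, x₀]`,
`t ↦ ∫_{[0,t]} g dν` is continuous from the right at every `t ∈ [0, x₀)` (dominated convergence).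
[folklore] -/
theorem continuousWithinAt_Ioi_integral_Icc {x₀ : ℝ} {ν : Measure ℝ} {g : ℝ → ℂ}
    (hg : IntegrableOn g (Icc 0 x₀) ν) {t : ℝ} (ht : t ∈ Ico 0 x₀) :
    ContinuousWithinAt (fun t' => ∫ u in Icc 0 t', g u ∂ν) (Ioi t) t := by
  have heq : ∀ t' ∈ Icc 0 x₀,
      ∫ u in Icc 0 t', g u ∂ν = ∫ u, (Iic t').indicator g u ∂(ν.restrict (Icc 0 x₀)) := by
    intro t' ht'
    have hset : Iic t' ∩ Icc 0 x₀ = Icc 0 t' := by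
      ext u
      simp only [mem_inter_iff, mem_Iic, mem_Icc]
      constructor
      · rintro ⟨h1, h2, -⟩
        exact ⟨h2, h1⟩
      · rintro ⟨h1, h2⟩
        exact ⟨h2, h1, h2.trans ht'.2⟩
    rw [integral_indicator measurableSet_Iic, Measure.restrict_restrict measurableSet_Iic, hset]
  have hmem : Icc 0 x₀ ∈ 𝓝[>] t := mem_of_superset (Ioo_mem_nhdsGT ht.2)
    (fun u hu => ⟨ht.1.trans hu.1.le, hu.2.le⟩)
  have hev : (fun t' => ∫ u, (Iic t').indicator g u ∂(ν.restrict (Icc 0 x₀))) =ᶠ[𝓝[>] t]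
      (fun t' => ∫ u in Icc 0 t', g u ∂ν) :=
    mem_of_superset hmem (fun t' ht' => (heq t' ht').symm)
  change Tendsto (fun t' => ∫ u in Icc 0 t', g u ∂ν) (𝓝[>] t) (𝓝 (∫ u in Icc 0 t, g u ∂ν))
  rw [heq t ⟨ht.1, ht.2.le⟩]
  refine Tendsto.congr' hev ?_
  refine tendsto_integral_filter_of_dominated_convergence (bound := fun u => ‖g u‖) ?_ ?_ hg.norm ?_
  · exact Eventually.of_forall (fun t' => hg.aestronglyMeasurable.indicator measurableSet_Iic)
  · exact Eventually.of_forall (fun t' => ae_of_all _ (fun u => norm_indicator_le_norm_self _ _))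
  · refine ae_of_all _ (fun u => ?_)
    rcases le_or_gt u t with hut | hut
    · have h1 : ∀ t' ∈ Ioi t, (Iic t').indicator g u = (Iic t).indicator g u := fun t' ht' => by
        rw [indicator_of_mem (show u ∈ Iic t' from hut.trans (le_of_lt ht')),
          indicator_of_mem (show u ∈ Iic t from hut)]
      exact (tendsto_const_nhds.congr' (mem_of_superset self_mem_nhdsWithin
        (fun t' ht' => (h1 t' ht').symm)))
    · have h1 : ∀ t' ∈ Ioo t u, (Iic t').indicator g u = (Iic t).indicator g u := fun t' ht' => by
        rw [indicator_of_notMem (show u ∉ Iic t' from fun h => absurd (lt_of_lt_of_le ht'.2 h)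
          (lt_irrefl _)), indicator_of_notMem (show u ∉ Iic t from fun h => absurd
          (lt_of_lt_of_le hut h) (lt_irrefl _))]
      exact (tendsto_const_nhds.congr' (mem_of_superset (Ioo_mem_nhdsGT hut)
        (fun t' ht' => (h1 t' ht').symm)))

namespace KreinString

variable (S : KreinString)

/-- The Picard iterates beyond the first vanish to the left of `0`. [folklore] -/
lemma picard_succ_of_neg (f : ℝ → ℝ) (n : ℕ) {x : ℝ} (hx : x < 0) : S.picard f (n + 1) x = 0 := by
  rw [picard_succ, Icc_eq_empty (not_le.2 hx), Measure.restrict_empty, integral_zero_measure]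

/-- `φ(x, z) = 1` for `x < 0` (only `[0, L)` is meaningful; recorded to make `ψ/φ` globally
monotone). [folklore] -/
lemma phi_of_neg (z : ℂ) {x : ℝ} (hx : x < 0) : S.phi z x = 1 := by
  rw [phi_eq]
  simp only
  rw [tsum_eq_single 0]
  · simp
  · intro n hn
    obtain ⟨k, rfl⟩ := Nat.exists_eq_succ_of_ne_zero hn
    simp [S.picard_succ_of_neg _ k hx]

/-- `ψ(x, z) = x` for `x < 0`. [folklore] -/
lemma psi_of_neg (z : ℂ) {x : ℝ} (hx : x < 0) : S.psi z x = x := by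
  rw [psi_eq]
  simp only
  rw [tsum_eq_single 0]
  · simp
  · intro n hn
    obtain ⟨k, rfl⟩ := Nat.exists_eq_succ_of_ne_zero hn
    simp [S.picard_succ_of_neg _ k hx]

/-- The right derivative of `φ(·, z)`: `φ⁺'(t) = -z ∫_{[0,t]} φ dm` at every `t ∈ [0, L)`
(within `[t, ∞)`). [cite: KacKrein1974, §1] -/
theorem hasDerivWithinAt_phi (z : ℂ) {t : ℝ} (ht : t ∈ S.dom) :
    HasDerivWithinAt (S.phi z) (-z * ∫ u in Icc 0 t, S.phi z u ∂S.massMeasure) (Ici t) t := by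
  obtain ⟨x₀, hx₀, htx₀⟩ := S.exists_mem_dom_gt ht
  set Φ : ℝ → ℂ := fun t => ∫ u in Icc 0 t, S.phi z u ∂S.massMeasure with hΦ
  have hμ : S.massMeasure (Icc 0 x₀) ≠ ⊤ := (S.massMeasure_Icc_lt_top hx₀).ne
  have hφi : IntegrableOn (S.phi z) (Icc 0 x₀) S.massMeasure :=
    S.integrableOn_Icc_of_continuousOn hx₀ ((S.isSolution_phi z).1.mono (S.Icc_subset_dom hx₀))
  have hΦi : IntegrableOn Φ (Icc 0 x₀) := integrableOn_integral_Icc hμ hφi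
  have ht' : t ∈ Ico 0 x₀ := ⟨ht.1, htx₀⟩
  -- FTC from the right for `u ↦ ∫₀ᵘ Φ`
  have hF : HasDerivWithinAt (fun u => ∫ s in (0 : ℝ)..u, Φ s) (Φ t) (Ici t) t := by
    refine intervalIntegral.integral_hasDerivWithinAt_right ?_ ?_
      (continuousWithinAt_Ioi_integral_Icc hφi ht')
    · exact (intervalIntegrable_iff_integrableOn_Ioc_of_le ht.1).2
        (hΦi.mono_set (Ioc_subset_Icc_self.trans (Icc_subset_Icc_right htx₀.le)))
    · exact _root_.AEStronglyMeasurable.stronglyMeasurableAtFilter_of_mem hΦi.aestronglyMeasurable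
        (mem_of_superset (Ioo_mem_nhdsGT htx₀) (fun u hu => ⟨ht.1.trans hu.1.le, hu.2.le⟩))
  have hderiv : HasDerivWithinAt (fun u => 1 - z * ∫ s in (0 : ℝ)..u, Φ s) (-(z * Φ t)) (Ici t) t :=
    (hF.const_mul z).const_sub 1
  -- `φ` agrees with this primitive on `[t, x₀]`
  have heq : ∀ u ∈ Icc t x₀, S.phi z u = 1 - z * ∫ s in (0 : ℝ)..u, Φ s := by
    intro u hu
    have hu0 : 0 ≤ u := ht.1.trans hu.1
    rw [S.phi_eq_one_sub_integral z (S.Icc_subset_dom hx₀ ⟨hu0, hu.2⟩),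
      intervalIntegral.integral_of_le hu0, integral_Icc_eq_integral_Ioc]
  refine (hderiv.congr_of_eventuallyEq ?_ (heq t ⟨le_rfl, htx₀.le⟩)).congr_deriv (by ring)
  exact mem_of_superset (Icc_mem_nhdsGE htx₀) (fun u hu => heq u hu)

/-- The right derivative of `ψ(·, z)`: `ψ⁺'(t) = 1 - z ∫_{[0,t]} ψ dm` at every `t ∈ [0, L)`
(within `[t, ∞)`). [cite: KacKrein1974, §1] -/
theorem hasDerivWithinAt_psi (z : ℂ) {t : ℝ} (ht : t ∈ S.dom) :
    HasDerivWithinAt (S.psi z) (1 - z * ∫ u in Icc 0 t, S.psi z u ∂S.massMeasure) (Ici t) t := by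
  obtain ⟨x₀, hx₀, htx₀⟩ := S.exists_mem_dom_gt ht
  set Ψ : ℝ → ℂ := fun t => ∫ u in Icc 0 t, S.psi z u ∂S.massMeasure with hΨ
  have hμ : S.massMeasure (Icc 0 x₀) ≠ ⊤ := (S.massMeasure_Icc_lt_top hx₀).ne
  have hψi : IntegrableOn (S.psi z) (Icc 0 x₀) S.massMeasure :=
    S.integrableOn_Icc_of_continuousOn hx₀ ((S.isSolution_psi z).1.mono (S.Icc_subset_dom hx₀))
  have hΨi : IntegrableOn Ψ (Icc 0 x₀) := integrableOn_integral_Icc hμ hψi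
  have ht' : t ∈ Ico 0 x₀ := ⟨ht.1, htx₀⟩
  have hF : HasDerivWithinAt (fun u => ∫ s in (0 : ℝ)..u, Ψ s) (Ψ t) (Ici t) t := by
    refine intervalIntegral.integral_hasDerivWithinAt_right ?_ ?_
      (continuousWithinAt_Ioi_integral_Icc hψi ht')
    · exact (intervalIntegrable_iff_integrableOn_Ioc_of_le ht.1).2
        (hΨi.mono_set (Ioc_subset_Icc_self.trans (Icc_subset_Icc_right htx₀.le)))
    · exact _root_.AEStronglyMeasurable.stronglyMeasurableAtFilter_of_mem hΨi.aestronglyMeasurable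
        (mem_of_superset (Ioo_mem_nhdsGT htx₀) (fun u hu => ⟨ht.1.trans hu.1.le, hu.2.le⟩))
  have hderiv : HasDerivWithinAt (fun u : ℝ => (u : ℂ) - z * ∫ s in (0 : ℝ)..u, Ψ s)
      (1 - z * Ψ t) (Ici t) t :=
    (Complex.ofRealCLM.hasDerivWithinAt).sub (hF.const_mul z)
  have heq : ∀ u ∈ Icc t x₀, S.psi z u = (u : ℂ) - z * ∫ s in (0 : ℝ)..u, Ψ s := by
    intro u hu
    have hu0 : 0 ≤ u := ht.1.trans hu.1
    rw [S.psi_eq_sub_integral z (S.Icc_subset_dom hx₀ ⟨hu0, hu.2⟩),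
      intervalIntegral.integral_of_le hu0, integral_Icc_eq_integral_Ioc]
  refine hderiv.congr_of_eventuallyEq ?_ (heq t ⟨le_rfl, htx₀.le⟩)
  exact mem_of_superset (Icc_mem_nhdsGE htx₀) (fun u hu => heq u hu)

/-- **`ψ/φ = ∫ φ⁻²` at finite depth** (Tomisaki 1988 (4.1)): if `φ(·, z)` has no zero on `[0, x]`,
`x ∈ [0, L)`, then `ψ(x, z)/φ(x, z) = ∫₀ˣ φ(t, z)⁻² dt` (quotient rule for right derivatives, the
Lagrange identity `φψ⁺' - φ⁺'ψ = 1`, and the fundamental theorem of calculus for right derivatives).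
[cite: Tomisaki1988, §4 (4.1)] -/
theorem psi_div_phi_eq_integral (z : ℂ) {x : ℝ} (hx : x ∈ S.dom)
    (hφ : ∀ t ∈ Icc 0 x, S.phi z t ≠ 0) :
    S.psi z x / S.phi z x = ∫ t in (0 : ℝ)..x, ((S.phi z t) ^ 2)⁻¹ := by
  have hφc : ContinuousOn (S.phi z) (Icc 0 x) := (S.isSolution_phi z).1.mono (S.Icc_subset_dom hx)
  have hψc : ContinuousOn (S.psi z) (Icc 0 x) := (S.isSolution_psi z).1.mono (S.Icc_subset_dom hx)
  have hcont : ContinuousOn (fun t => S.psi z t / S.phi z t) (Icc 0 x) := hψc.div hφc hφ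
  have hderiv : ∀ t ∈ Ioo 0 x,
      HasDerivWithinAt (fun t => S.psi z t / S.phi z t) ((S.phi z t) ^ 2)⁻¹ (Ioi t) t := by
    intro t ht
    have htd : t ∈ S.dom := S.Icc_subset_dom hx ⟨ht.1.le, ht.2.le⟩
    have h := ((S.hasDerivWithinAt_psi z htd).div (S.hasDerivWithinAt_phi z htd)
      (hφ t ⟨ht.1.le, ht.2.le⟩)).mono (Ioi_subset_Ici_self (a := t))
    refine h.congr_deriv ?_
    have hW := S.wronskian_phi_psi z htd
    rw [show (1 - z * ∫ u in Icc 0 t, S.psi z u ∂S.massMeasure) * S.phi z t -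
        S.psi z t * (-z * ∫ u in Icc 0 t, S.phi z u ∂S.massMeasure) = 1 by
      linear_combination hW]
    rw [inv_eq_one_div]
  have hint : IntervalIntegrable (fun t => ((S.phi z t) ^ 2)⁻¹) volume 0 x :=
    ((hφc.pow 2).inv₀ (fun t ht => pow_ne_zero 2 (hφ t ht))).intervalIntegrable_of_Icc hx.1
  rw [intervalIntegral.integral_eq_sub_of_hasDeriv_right_of_le hx.1 hcont hderiv hint,
    S.psi_apply_zero, S.phi_apply_zero]
  simp

/-- On the negative axis `φ` has no zeros, so `ψ(x, -s)/φ(x, -s) = ∫₀ˣ φ(t, -s)⁻² dt` on `[0, L)`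
for every `s ≥ 0`, as a real integral. [cite: Tomisaki1988, §4 (4.1)] -/
theorem psi_div_phi_neg_eq_integral {s : ℝ} (hs : 0 ≤ s) {x : ℝ} (hx : x ∈ S.dom) :
    S.psi (-(s : ℂ)) x / S.phi (-(s : ℂ)) x =
      ((∫ t in (0 : ℝ)..x, ((S.phi (-(s : ℂ)) t).re ^ 2)⁻¹ : ℝ) : ℂ) := by
  rw [S.psi_div_phi_eq_integral _ hx (fun t ht => S.phi_neg_ne_zero hs (S.Icc_subset_dom hx ht)),
    ← intervalIntegral.integral_ofReal]
  refine intervalIntegral.integral_congr (fun t _ => ?_)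
  have hre : S.phi (-(s : ℂ)) t = ((S.phi (-(s : ℂ)) t).re : ℂ) :=
    Complex.ext (by simp) (by simp [S.phi_neg_im s t])
  rw [hre]
  push_cast
  simp

/-! ### The quotient `ψ(x,-s)/φ(x,-s)` as a real function of `x` -/

/-- At `z = -s` the quotient `ψ/φ` is real: `ψ(x,-s)/φ(x,-s) = Re(ψ(x,-s)/φ(x,-s))` (for every real
`x`). [folklore] -/
lemma psi_div_phi_neg_ofReal (s x : ℝ) :
    S.psi (-(s : ℂ)) x / S.phi (-(s : ℂ)) x =
      ((S.psi (-(s : ℂ)) x / S.phi (-(s : ℂ)) x).re : ℂ) := by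
  rw [S.phi_neg_ofReal, S.psi_neg_ofReal, ← Complex.ofReal_div, Complex.ofReal_re]

/-- `Re(ψ(x,-s)/φ(x,-s)) = ∫₀ˣ (Re φ(t,-s))⁻² dt` on `[0, L)` (`s ≥ 0`).
[cite: Tomisaki1988, §4 (4.1)] -/
theorem psi_div_phi_neg_re {s : ℝ} (hs : 0 ≤ s) {x : ℝ} (hx : x ∈ S.dom) :
    (S.psi (-(s : ℂ)) x / S.phi (-(s : ℂ)) x).re =
      ∫ t in (0 : ℝ)..x, ((S.phi (-(s : ℂ)) t).re ^ 2)⁻¹ := by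
  rw [S.psi_div_phi_neg_eq_integral hs hx, Complex.ofReal_re]

/-- To the left of `0` the quotient is the identity: `ψ(x,-s)/φ(x,-s) = x` for `x < 0`.
[folklore] -/
lemma psi_div_phi_neg_re_of_neg (s : ℝ) {x : ℝ} (hx : x < 0) :
    (S.psi (-(s : ℂ)) x / S.phi (-(s : ℂ)) x).re = x := by
  rw [S.phi_of_neg _ hx, S.psi_of_neg _ hx, div_one, Complex.ofReal_re]

/-- The integrand `(Re φ(t,-s))⁻²` is continuous on `[0, x]`, `x ∈ [0, L)`. [folklore] -/
lemma continuousOn_inv_phi_neg_re_sq (s : ℝ) {x : ℝ} (hs : 0 ≤ s) (hx : x ∈ S.dom) :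
    ContinuousOn (fun t => ((S.phi (-(s : ℂ)) t).re ^ 2)⁻¹) (Icc 0 x) := by
  have hφc : ContinuousOn (S.phi (-(s : ℂ))) (Icc 0 x) :=
    (S.isSolution_phi _).1.mono (S.Icc_subset_dom hx)
  refine ((Complex.continuous_re.comp_continuousOn hφc).pow 2).inv₀ (fun t ht => ?_)
  have h1 := S.one_le_phi_neg_re hs (S.Icc_subset_dom hx ht)
  have h2 : 0 < (S.phi (-(s : ℂ)) t).re := by linarith
  show (S.phi (-(s : ℂ)) t).re ^ 2 ≠ 0
  positivity

/-- `0 ≤ Re(ψ(x,-s)/φ(x,-s))` on `[0, L)`. [folklore] -/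
lemma psi_div_phi_neg_re_nonneg {s : ℝ} (hs : 0 ≤ s) {x : ℝ} (hx : x ∈ S.dom) :
    0 ≤ (S.psi (-(s : ℂ)) x / S.phi (-(s : ℂ)) x).re := by
  rw [S.psi_div_phi_neg_re hs hx]
  exact intervalIntegral.integral_nonneg hx.1 (fun t _ => by positivity)

/-- `0 < Re(ψ(x,-s)/φ(x,-s))` for `0 < x < L`. [folklore] -/
lemma psi_div_phi_neg_re_pos {s : ℝ} (hs : 0 ≤ s) {x : ℝ} (hx : x ∈ S.dom) (hx0 : 0 < x) :
    0 < (S.psi (-(s : ℂ)) x / S.phi (-(s : ℂ)) x).re := by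
  rw [S.psi_div_phi_neg_re hs hx]
  refine intervalIntegral.intervalIntegral_pos_of_pos_on
    ((S.continuousOn_inv_phi_neg_re_sq s hs hx).intervalIntegrable_of_Icc hx.1) (fun t ht => ?_) hx0
  have h1 := S.one_le_phi_neg_re hs (S.Icc_subset_dom hx ⟨ht.1.le, ht.2.le⟩)
  positivity

/-- **Monotonicity of the finite-depth Weyl quotients**: for `s ≥ 0`,
`x ↦ ψ(x,-s)/φ(x,-s)` is non-decreasing on `(-∞, L)`. [cite: Tomisaki1988, §4 (4.1)] -/
theorem psi_div_phi_neg_re_mono {s : ℝ} (hs : 0 ≤ s) {x y : ℝ} (hy : y ∈ S.dom) (hxy : x ≤ y) :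
    (S.psi (-(s : ℂ)) x / S.phi (-(s : ℂ)) x).re ≤
      (S.psi (-(s : ℂ)) y / S.phi (-(s : ℂ)) y).re := by
  rcases lt_or_ge x 0 with hx0 | hx0
  · rw [S.psi_div_phi_neg_re_of_neg s hx0]
    exact hx0.le.trans (S.psi_div_phi_neg_re_nonneg hs hy)
  · have hx : x ∈ S.dom := ⟨hx0, (ENNReal.ofReal_le_ofReal hxy).trans_lt hy.2⟩
    rw [S.psi_div_phi_neg_re hs hx, S.psi_div_phi_neg_re hs hy]
    exact intervalIntegral.integral_mono_interval le_rfl hx0 hxy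
      (ae_of_all _ (fun t => by positivity))
      ((S.continuousOn_inv_phi_neg_re_sq s hs hy).intervalIntegrable_of_Icc hy.1)

/-- Monotonicity of `x ↦ ψ(x,-s)/φ(x,-s)` for pairs of points to the left of `0` (where it is
the identity). [folklore] -/
lemma psi_div_phi_neg_re_mono_of_neg (s : ℝ) {x y : ℝ} (hy : y < 0) (hxy : x ≤ y) :
    (S.psi (-(s : ℂ)) x / S.phi (-(s : ℂ)) x).re ≤
      (S.psi (-(s : ℂ)) y / S.phi (-(s : ℂ)) y).re := by
  rw [S.psi_div_phi_neg_re_of_neg s hy, S.psi_div_phi_neg_re_of_neg s (lt_of_le_of_lt hxy hy)]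
  exact hxy

/-- The trivial bound `ψ(x,-s)/φ(x,-s) ≤ x` on `[0, L)` (since `φ ≥ 1`). [folklore] -/
theorem psi_div_phi_neg_re_le {s : ℝ} (hs : 0 ≤ s) {x : ℝ} (hx : x ∈ S.dom) :
    (S.psi (-(s : ℂ)) x / S.phi (-(s : ℂ)) x).re ≤ x := by
  rw [S.psi_div_phi_neg_re hs hx]
  calc ∫ t in (0 : ℝ)..x, ((S.phi (-(s : ℂ)) t).re ^ 2)⁻¹ ≤ ∫ _ in (0 : ℝ)..x, (1 : ℝ) :=
        intervalIntegral.integral_mono_on hx.1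
          ((S.continuousOn_inv_phi_neg_re_sq s hs hx).intervalIntegrable_of_Icc hx.1)
          intervalIntegrable_const (fun t ht =>
            inv_le_one_of_one_le₀ (one_le_pow₀ (S.one_le_phi_neg_re hs (S.Icc_subset_dom hx ht))))
    _ = x := by simp

/-- The primitive of `(1 + c (t - a))⁻²`: `∫ₐˣ (1 + c(t-a))⁻² dt ≤ c⁻¹` for `c > 0`, `a ≤ x`.
[folklore] -/
lemma integral_inv_one_add_mul_sq_le {c a x : ℝ} (hc : 0 < c) (hax : a ≤ x) :
    ∫ t in a..x, ((1 + c * (t - a)) ^ 2)⁻¹ ≤ c⁻¹ := by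
  have hpos : ∀ t ∈ Icc a x, 0 < 1 + c * (t - a) := fun t ht => by nlinarith [ht.1]
  have hderiv : ∀ t ∈ uIcc a x,
      HasDerivAt (fun t => -(c * (1 + c * (t - a)))⁻¹) (((1 + c * (t - a)) ^ 2)⁻¹) t := by
    intro t ht
    rw [uIcc_of_le hax] at ht
    have h0 : c * (1 + c * (t - a)) ≠ 0 := mul_ne_zero hc.ne' (hpos t ht).ne'
    have h1 : HasDerivAt (fun t => c * (1 + c * (t - a))) (c * (c * 1)) t :=
      ((((hasDerivAt_id t).sub_const a).const_mul c).const_add 1).const_mul c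
    refine ((h1.inv h0).neg).congr_deriv ?_
    field_simp
  have hcont : ContinuousOn (fun t => ((1 + c * (t - a)) ^ 2)⁻¹) (Icc a x) :=
    ((continuousOn_const.add (continuousOn_const.mul (continuousOn_id.sub continuousOn_const))).pow
      2).inv₀ (fun t ht => (pow_pos (hpos t ht) 2).ne')
  rw [intervalIntegral.integral_eq_sub_of_hasDerivAt hderiv (hcont.intervalIntegrable_of_Icc hax)]
  have hx1 : 0 < 1 + c * (x - a) := hpos x ⟨hax, le_rfl⟩
  have : 0 ≤ (c * (1 + c * (x - a)))⁻¹ := by positivity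
  simp only [sub_self, mul_zero, add_zero, mul_one]
  linarith

/-- **Boundedness on the singular half-line**: if the string carries mass on `[0, a]` (`m(a) > 0`),
then for `s > 0` and `a ≤ x < L`, `ψ(x,-s)/φ(x,-s) ≤ a + (s m(a))⁻¹`, because
`φ(t,-s) ≥ 1 + s (t-a) m(a)` for `t ≥ a`. [cite: Tomisaki1988, §4] -/
theorem psi_div_phi_neg_re_le_of_mass {s : ℝ} (hs : 0 < s) {a : ℝ} (ha : 0 ≤ a)
    (hma : 0 < S.mass a) {x : ℝ} (hx : x ∈ S.dom) (hax : a ≤ x) :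
    (S.psi (-(s : ℂ)) x / S.phi (-(s : ℂ)) x).re ≤ a + (s * S.mass a)⁻¹ := by
  have hc : 0 < s * S.mass a := mul_pos hs hma
  have had : a ∈ S.dom := ⟨ha, (ENNReal.ofReal_le_ofReal hax).trans_lt hx.2⟩
  have hint : IntervalIntegrable (fun t => ((S.phi (-(s : ℂ)) t).re ^ 2)⁻¹) volume 0 x :=
    (S.continuousOn_inv_phi_neg_re_sq s hs.le hx).intervalIntegrable_of_Icc hx.1
  rw [S.psi_div_phi_neg_re hs.le hx, ← intervalIntegral.integral_add_adjacent_intervals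
    (hint.mono_set (by rw [uIcc_of_le ha, uIcc_of_le hx.1]; exact Icc_subset_Icc_right hax))
    (hint.mono_set (by rw [uIcc_of_le hax, uIcc_of_le hx.1]; exact Icc_subset_Icc_left ha))]
  have h1 : ∫ t in (0 : ℝ)..a, ((S.phi (-(s : ℂ)) t).re ^ 2)⁻¹ ≤ a := by
    have := S.psi_div_phi_neg_re_le hs.le had
    rwa [S.psi_div_phi_neg_re hs.le had] at this
  have h2 : ∫ t in a..x, ((S.phi (-(s : ℂ)) t).re ^ 2)⁻¹ ≤ (s * S.mass a)⁻¹ := by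
    refine le_trans ?_ (integral_inv_one_add_mul_sq_le hc hax)
    refine intervalIntegral.integral_mono_on hax
      (hint.mono_set (by rw [uIcc_of_le hax, uIcc_of_le hx.1]; exact Icc_subset_Icc_left ha))
      ?_ (fun t ht => ?_)
    · refine ContinuousOn.intervalIntegrable_of_Icc hax ?_
      refine ((continuousOn_const.add (continuousOn_const.mul
        (continuousOn_id.sub continuousOn_const))).pow 2).inv₀ (fun t ht => ?_)
      have : 0 < 1 + s * S.mass a * (t - a) := by nlinarith [ht.1]
      show (1 + s * S.mass a * (t - a)) ^ 2 ≠ 0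
      positivity
    · have hlow := S.phi_neg_re_ge hs.le ha ht.1 (S.Icc_subset_dom hx ⟨ha.trans ht.1, ht.2⟩)
      have hpos : 0 < 1 + s * S.mass a * (t - a) := by nlinarith [ht.1]
      have hle : 1 + s * S.mass a * (t - a) ≤ (S.phi (-(s : ℂ)) t).re := by nlinarith [hlow]
      gcongr
  linarith

/-- A string of infinite length which is not the free half-line carries mass on some `[0, n]`.
[folklore] -/
lemma exists_mass_pos (hL : S.length = ⊤) (hS : ¬ S.IsTrivial) : ∃ n : ℕ, 0 < S.mass n := by
  by_contra h
  push Not at h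
  apply hS
  refine ⟨hL, ?_⟩
  have hn : ∀ n : ℕ, S.massMeasure (Icc 0 n) = 0 := by
    intro n
    have hdom : (n : ℝ) ∈ S.dom := ⟨n.cast_nonneg, by simp [hL]⟩
    have hfin := (S.massMeasure_Icc_lt_top hdom).ne
    have h0 := le_antisymm (h n) (S.mass_nonneg n)
    rw [S.mass_eq_toReal_Icc] at h0
    exact (ENNReal.toReal_eq_zero_iff _).1 h0 |>.resolve_right hfin
  have hIci : S.massMeasure (Ici 0) = 0 := by
    have hsub : Ici (0 : ℝ) ⊆ ⋃ n : ℕ, Icc (0 : ℝ) n := fun x hx => by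
      obtain ⟨n, hn⟩ := exists_nat_ge x
      exact mem_iUnion.2 ⟨n, hx, hn⟩
    exact measure_mono_null hsub (measure_iUnion_null_iff.2 hn)
  rw [← Measure.measure_univ_eq_zero, ← Iio_union_Ici (a := (0 : ℝ))]
  exact measure_union_null S.massMeasure_Iio_zero hIci

/-- The end filter of a string is non-trivial. [folklore] -/
lemma toEnd_neBot : S.toEnd.NeBot := by
  unfold toEnd
  split_ifs <;> infer_instance

/-- **Existence of the principal Titchmarsh–Weyl function on the negative axis**
(Tomisaki 1988 (4.1); Kac–Kreĭn 1974 §2): for every Kreĭn string other than the free half-line and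
every `s > 0`, `ψ(x,-s)/φ(x,-s)` converges as `x → L` to a positive real number `q_S(-s)`
(`= sup_x ∫₀ˣ φ(t,-s)⁻² dt = ∫₀ᴸ φ(t,-s)⁻² dt`). [cite: Tomisaki1988, §4 (4.1)] -/
theorem exists_tendsto_psi_div_phi_neg (hS : ¬ S.IsTrivial) {s : ℝ} (hs : 0 < s) :
    ∃ q : ℝ, 0 < q ∧
      Tendsto (fun x => S.psi (-(s : ℂ)) x / S.phi (-(s : ℂ)) x) S.toEnd (𝓝 (q : ℂ)) := by
  set g : ℝ → ℝ := fun x => (S.psi (-(s : ℂ)) x / S.phi (-(s : ℂ)) x).re with hg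
  have hfun : (fun x => S.psi (-(s : ℂ)) x / S.phi (-(s : ℂ)) x) = fun x => ((g x : ℝ) : ℂ) :=
    funext (fun x => S.psi_div_phi_neg_ofReal s x)
  rw [hfun]
  -- it suffices to find the real limit of `g` along the end filter
  suffices h : ∃ q : ℝ, 0 < q ∧ Tendsto g S.toEnd (𝓝 q) by
    obtain ⟨q, hq, h⟩ := h
    exact ⟨q, hq, (Complex.continuous_ofReal.tendsto q).comp h⟩
  unfold toEnd
  by_cases hL : S.length = ⊤
  · -- singular half-line `L = ∞`: `g` is monotone on `ℝ` and bounded by `a + (s m(a))⁻¹`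
    rw [if_pos hL]
    have hdom : ∀ {y : ℝ}, 0 ≤ y → y ∈ S.dom := fun hy => ⟨hy, by simp [hL]⟩
    have hmono : Monotone g := by
      intro x y hxy
      rcases lt_or_ge y 0 with hy | hy
      · exact S.psi_div_phi_neg_re_mono_of_neg s hy hxy
      · exact S.psi_div_phi_neg_re_mono hs.le (hdom hy) hxy
    obtain ⟨n, hn⟩ := S.exists_mass_pos hL hS
    have hbdd : BddAbove (range g) := by
      refine ⟨(n : ℝ) + (s * S.mass n)⁻¹, ?_⟩
      rintro _ ⟨x, rfl⟩
      rcases le_total (n : ℝ) x with hnx | hxn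
      · exact S.psi_div_phi_neg_re_le_of_mass hs n.cast_nonneg hn (hdom (n.cast_nonneg.trans hnx))
          hnx
      · exact (hmono hxn).trans (S.psi_div_phi_neg_re_le_of_mass hs n.cast_nonneg hn
          (hdom n.cast_nonneg) le_rfl)
    refine ⟨⨆ x, g x, ?_, tendsto_atTop_ciSup hmono hbdd⟩
    exact lt_of_lt_of_le (S.psi_div_phi_neg_re_pos hs.le (hdom zero_le_one) zero_lt_one)
      (le_ciSup hbdd 1)
  · -- `L < ∞`: `g` is monotone on `(-∞, L)` and bounded by `L`
    rw [if_neg hL]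
    have hL0 : 0 < S.length.toReal := ENNReal.toReal_pos S.length_pos.ne' hL
    have hdom : ∀ {y : ℝ}, 0 ≤ y → y < S.length.toReal → y ∈ S.dom := fun hy hyL =>
      ⟨hy, (ENNReal.ofReal_lt_iff_lt_toReal hy hL).2 hyL⟩
    have hmono : MonotoneOn g (Iio S.length.toReal) := by
      intro x _ y hy hxy
      rcases lt_or_ge y 0 with hy0 | hy0
      · exact S.psi_div_phi_neg_re_mono_of_neg s hy0 hxy
      · exact S.psi_div_phi_neg_re_mono hs.le (hdom hy0 hy) hxy
    have hbdd : BddAbove (g '' Iio S.length.toReal) := by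
      refine ⟨S.length.toReal, ?_⟩
      rintro _ ⟨x, hx, rfl⟩
      rcases lt_or_ge x 0 with hx0 | hx0
      · show (S.psi (-(s : ℂ)) x / S.phi (-(s : ℂ)) x).re ≤ _
        rw [S.psi_div_phi_neg_re_of_neg s hx0]
        exact hx0.le.trans hL0.le
      · exact (S.psi_div_phi_neg_re_le hs.le (hdom hx0 hx)).trans (le_of_lt hx)
    refine ⟨sSup (g '' Iio S.length.toReal), ?_, hmono.tendsto_nhdsLT hbdd⟩
    have hhalf : S.length.toReal / 2 ∈ Iio S.length.toReal := by
      simp only [mem_Iio]; linarith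
    exact lt_of_lt_of_le
      (S.psi_div_phi_neg_re_pos hs.le (hdom (by positivity) hhalf) (by positivity))
      (le_csSup hbdd ⟨_, hhalf, rfl⟩)

/-- **Part (i) of Kreĭn's theorem on the negative axis.** For every Kreĭn string other than the
free half-line `S[0, ∞]` and every `z ∈ (-∞, 0)`, the limit `q_S(z) = lim_{x → L} ψ(x,z)/φ(x,z)`
defining the principal Titchmarsh–Weyl function exists, and `q_S(z)` is a positive real number.
[cite: Tomisaki1988, §4 (4.1)] -/
theorem tendsto_principalWeylFunction_of_neg (hS : ¬ S.IsTrivial) {z : ℂ} (hz : z.im = 0)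
    (hz' : z.re < 0) :
    Tendsto (fun x => S.psi z x / S.phi z x) S.toEnd (𝓝 (S.principalWeylFunction z)) ∧
      0 < (S.principalWeylFunction z).re ∧ (S.principalWeylFunction z).im = 0 := by
  haveI := S.toEnd_neBot
  have hzs : z = -(((-z.re : ℝ)) : ℂ) := Complex.ext (by simp) (by simp [hz])
  obtain ⟨q, hq, h⟩ := S.exists_tendsto_psi_div_phi_neg hS (s := -z.re) (by linarith)
  rw [← hzs] at h
  have hlim : S.principalWeylFunction z = q := h.limUnder_eq
  refine ⟨?_, ?_, ?_⟩
  · rw [hlim]; exact h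
  · rw [hlim, Complex.ofReal_re]; exact hq
  · rw [hlim, Complex.ofReal_im]

end KreinString

end Literature.Analysis.InverseSpectral

end
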